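import Summits.CriticalPhenomena.PercolationContinuityZ3.Theorems.PercNearOneGluingNoHeavyLowerTailCSHPeel
import Summits.CriticalPhenomena.PercolationContinuityZ3.Theorems.PercNearOneGluingAdditiveGluingS5Assembly
import Summits.CriticalPhenomena.PercolationContinuityZ3.Theorems.PercNearOneGluingNoHeavyAllDimensions
import Summits.CriticalPhenomena.PercolationContinuityZ3.Theorems.PercNearOneGluingNoHeavyLowerTailOfAdditiveGluing
import HarnessLib

/-!
# From the conditioned slack hierarchy to additive gluing, Kozma–Nitzan's Conjecture 3 and `θ(p_c) = 0` in every dimension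

Every theorem in this file takes as hypothesis `hCSH` the conditioned slack hierarchy `CSH.CSHHolds` for non-degenerate weights
(`0 < w e < 1`) and pairwise distinct named vertices, in the `Fin n` / `Finset` form (the statement of `CSH.cshAll`), and derives:
* `CSH.additiveGluing_of_csh` — the additive gluing inequality `PercNearOneGluing.AdditiveGluing`, by the surplus-margin bound
  `CSH.s5dMargin_nonneg_of_csh` plugged into `CSH.additiveGluing_of_s5dMargin_nondegenerate` (degenerate observers + closure over
  degenerate weights via the min-form of the surplus);
* `CSH.conjecture3_of_csh` — Kozma–Nitzan's Conjecture 3, from additive gluing;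
* `CSH.percolationContinuity_of_csh` — `θ_{ℤ^d}(p_c) = 0` for all `d ≥ 2`, from Conjecture 3 and Kozma–Nitzan's Theorem 6
  (`KozmaNitzan2024_thm6_holds`);
* `CSH.noHeavyLowerTail_of_csh` — the lower-tail form `PercNearOneGluingNoHeavy.NoHeavyLowerTail` of Conjecture 3, from additive gluing.
[cite: KozmaNitzan2024, Conj. 1 (p. 3), Conj. 3 (p. 15), Conj. 4 (p. 32), Thm. 6]
-/

noncomputable section

namespace Summit.CriticalPhenomena.PercolationContinuityZ3.Theorems

open MeasureTheory Set Literature.Probability.LatticeModels Literature.Probability.Percolation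
open scoped Classical
open Summit.CriticalPhenomena.PercolationContinuityZ3.Theses

namespace CSH

/-- **Additive gluing `PercNearOneGluing.AdditiveGluing` from the conditioned slack hierarchy** (hypothesis `hCSH`: `CSH.CSHHolds`
for non-degenerate weights and pairwise distinct named vertices, the statement of `CSH.cshAll`), via `CSH.s5dMargin_nonneg_of_csh` and
`CSH.additiveGluing_of_s5dMargin_nondegenerate`.  The statement is the additive form implied by [cite: KozmaNitzan2024, Conj. 1 (p. 3)] -/
theorem additiveGluing_of_csh
    (hCSH : ∀ (n : ℕ) (w : Sym2 (Fin n) → unitInterval), (∀ e, 0 < w e ∧ w e < 1) →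
      ∀ (o v x : Fin n) (Y : Finset (Fin n)) (D : List (Fin n)),
      o ≠ v → x ∉ Y → o ≠ x → v ≠ x → o ∉ Y → v ∉ Y → D.Nodup → (∀ d ∈ D, d ≠ x ∧ d ∉ Y ∧ d ≠ o ∧ d ≠ v) →
      CSHHolds w x (↑Y : Set (Fin n)) D o v) :
    PercNearOneGluing.AdditiveGluing :=
  additiveGluing_of_s5dMargin_nondegenerate fun n p hp T o v F r hoT hvT hov hF _ hr hcompat =>
    s5dMargin_nonneg_of_csh p hp o v (fun x Y D => hCSH n p hp o v x Y D hov) T r [] F hF hr hcompat hoT hvT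
      List.nodup_nil (fun _ hd => absurd hd List.not_mem_nil)

/-- **Kozma–Nitzan's Conjecture 3 from the conditioned slack hierarchy.** [cite: KozmaNitzan2024, Conjecture 3 (p. 15)] -/
theorem conjecture3_of_csh
    (hCSH : ∀ (n : ℕ) (w : Sym2 (Fin n) → unitInterval), (∀ e, 0 < w e ∧ w e < 1) →
      ∀ (o v x : Fin n) (Y : Finset (Fin n)) (D : List (Fin n)),
      o ≠ v → x ∉ Y → o ≠ x → v ≠ x → o ∉ Y → v ∉ Y → D.Nodup → (∀ d ∈ D, d ≠ x ∧ d ∉ Y ∧ d ≠ o ∧ d ≠ v) →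
      CSHHolds w x (↑Y : Set (Fin n)) D o v) :
    KozmaNitzan2024_conjecture3 :=
  nearOneGluing_iff_conjecture3.1 (additiveGluingGlue_proof (additiveGluing_of_csh hCSH))

/-- **`θ_{ℤ^d}(p_c) = 0` for every `d ≥ 2` from the conditioned slack hierarchy.** [cite: KozmaNitzan2024, Thm. 6 with Conj. 3 (p. 15)] -/
theorem percolationContinuity_of_csh
    (hCSH : ∀ (n : ℕ) (w : Sym2 (Fin n) → unitInterval), (∀ e, 0 < w e ∧ w e < 1) →
      ∀ (o v x : Fin n) (Y : Finset (Fin n)) (D : List (Fin n)),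
      o ≠ v → x ∉ Y → o ≠ x → v ≠ x → o ∉ Y → v ∉ Y → D.Nodup → (∀ d ∈ D, d ≠ x ∧ d ∉ Y ∧ d ≠ o ∧ d ≠ v) →
      CSHHolds w x (↑Y : Set (Fin n)) D o v)
    (d : ℕ) (hd : 2 ≤ d) : PercolationContinuity d :=
  percolationContinuity_of_additiveGluing (additiveGluing_of_csh hCSH) d hd

/-- **The lower-tail form `PercNearOneGluingNoHeavy.NoHeavyLowerTail` of Conjecture 3 from the conditioned slack hierarchy** —
through `CSH.additiveGluing_of_csh` and `noHeavyLowerTail_of_additiveGluing` (AdditiveGluing ⟹ NearOneGluing ⟹ many fingers /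
large pocket ⟹ NoHeavyLowerTail); additive gluing is the additive form implied by [cite: KozmaNitzan2024, Conj. 1 (p. 3)] -/
theorem noHeavyLowerTail_of_csh
    (hCSH : ∀ (n : ℕ) (w : Sym2 (Fin n) → unitInterval), (∀ e, 0 < w e ∧ w e < 1) →
      ∀ (o v x : Fin n) (Y : Finset (Fin n)) (D : List (Fin n)),
      o ≠ v → x ∉ Y → o ≠ x → v ≠ x → o ∉ Y → v ∉ Y → D.Nodup → (∀ d ∈ D, d ≠ x ∧ d ∉ Y ∧ d ≠ o ∧ d ≠ v) →
      CSHHolds w x (↑Y : Set (Fin n)) D o v) :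
    PercNearOneGluingNoHeavy.NoHeavyLowerTail :=
  noHeavyLowerTail_of_additiveGluing (additiveGluing_of_csh hCSH)

end CSH

end Summit.CriticalPhenomena.PercolationContinuityZ3.Theorems
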